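import Summits.QuantumFields.YangMills.Theorems.BalabanLadderUVSeamRecChessboardPlaquetteExpMoment
import HarnessLib

/-!
# Crux `UVSeamRec` (stmt-QuantumFields-20043): the LINEAR chord of the torus free energy and the small-`c` chessboard bound —
# `⟨exp(c Σ_{q∈P} φ_q)⟩_{Λ_M,β} ≤ exp(#P · (c/β) · (1944 + 144 log β/M))` (`SU(2)`, odd four-torus), the Gaussian-scale currency

Helper file (`--supports stmt-QuantumFields-20043`) of the LEAD seat `ym-spine-20043-p1` (gen 17); sequel of `…ChessboardPlaquetteExpMoment`
(p640498), whose chord is the `c = β/2` endpoint.  For SMALL `c` the supporting-line inequality of the convex `log Z` at `β − c`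
(`log Z(β−c) − log Z(β) ≤ c·⟨S⟩_{β−c}`, `WilsonEnergyConvexity.mul_wilsonExpectation_wilsonAction_le`) and g11's torus thermal ceiling
`⟨φ⟩_b ≤ 27/b + 2 log b/(M b)` (`ThermalFloor.wilsonExpectation_two_sub_trace_le_su2`) give an exponent LINEAR in `c/β` — the Gaussian scaling
`φ ≍ 1/β`:
* `su2_torusLogPartition_sub_le_linear` — `log Z_M(β−c) − log Z_M(β) ≤ c·6M⁴·(27/(β−c) + 2 log(β−c)/(M(β−c)))` (`0 ≤ c`, `β − c ≥ 2`, `M ≥ 2`);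
* `su2_wilsonExpectation_expObs_le_linear_orient` — one orientation: `⟨exp(cΣ_{q∈P}φ_q)⟩ ≤ exp(#P·6c·(27/(β−c) + 2 log(β−c)/(M(β−c))))`;
* `su2_wilsonExpectation_expObs_le_linear` — all orientations, `β ≥ 4`, `0 ≤ c ≤ β/12`: `⟨exp(cΣ_{q∈P}φ_q)⟩ ≤ exp(#P·(c/β)·(1944 + 144 log β/M))`.
The sequel (`…CarrierExpMomentFixedScale`, appended) turns this into the budget `B ∝ R⁴(2R+4)⁴/C` of the fixed-scale rung of `stub_gaussianDomination`
— hence a carrier constant `C ∝ R⁸` gives (EM_Q) UNIFORMLY in `R`: the open content of the stub is exactly the factor `R⁸` in `C`.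

HONEST FRAMING: reflection positivity + convexity + g11's explicit Laplace bounds; nothing of E0′, NT or the gap; YM mass gap NOT proved; not Clay.

References: Fröhlich–Israel–Lieb–Simon, CMP 62 (1978) Thm. 4.1; Seiler, LNP 159 (1982) Ch. 4.
-/

open MeasureTheory Finset
open Literature.MathematicalPhysics.QuantumFieldTheory
open Literature.MathematicalPhysics.QuantumLattice (fundamentalRep fundamentalRep_mem_unitaryGroup continuous_fundamentalRep
  secondCountableTopology_su2 torusLogPartition)
open Summit.QuantumFields.YangMills.Theorems.SoloBlind (expObs plaquetteCost plaquetteCost_nonneg torusLogPartition_sub_nonneg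
  exists_abs_expObs_le measurable_expObs)
open Summit.QuantumFields.YangMills.Theorems.OddTorusChessboard (wilsonExpectation_expObs_le_exp_card)
open Summit.QuantumFields.YangMills.Cruxes.UVSeamRec.ClassicalResponse.ThermalFloor

noncomputable section

namespace Summit.QuantumFields.YangMills.Cruxes.UVSeamRec.Chessboard

/-! ### §1 The linear chord and the small-`c` chessboard bound -/

/-- **The LINEAR chord (`SU(2)`, every volume).**  For `0 ≤ c`, `β − c ≥ 2`, `M ≥ 2`:
`log Z_M(β − c) − log Z_M(β) ≤ c · 6M⁴ · (27/(β−c) + 2 log(β−c)/(M(β−c)))` — the supporting line of the convex `log Z` at `β − c` and the torus thermal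
ceiling `ThermalFloor.wilsonExpectation_two_sub_trace_le_su2` at `b = β − c`. [folklore] -/
theorem su2_torusLogPartition_sub_le_linear {M : ℕ} [NeZero M] [Fact (1 < M)] {β c : ℝ} (hc : 0 ≤ c) (hβc : 2 ≤ β - c) :
    torusLogPartition 4 (fundamentalRep (Fin 2)) (β - c) M -
        torusLogPartition 4 (G := Matrix.specialUnitaryGroup (Fin 2) ℂ) (fundamentalRep (Fin 2)) β M ≤
      c * (6 * (M : ℝ) ^ 4 * (27 / (β - c) + 2 * Real.log (β - c) / (M * (β - c)))) := by
  set ρ := fundamentalRep (Fin 2) with hρdef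
  have hρ : Continuous ρ := continuous_fundamentalRep (Fin 2)
  -- supporting line at `β − c`
  have hsl := mul_wilsonExpectation_wilsonAction_le (d := 4) (L := M) (G := Matrix.specialUnitaryGroup (Fin 2) ℂ) ρ hρ (β - c) β
  have e1 : β - c - β = -c := by ring
  rw [e1] at hsl
  -- mean action = 6M⁴ × mean plaquette cost, bounded by the torus thermal ceiling at `b = β − c`
  have hmean := Summit.QuantumFields.YangMills.Theorems.SoloBlind.wilsonExpectation_wilsonAction_eq_card_mul (d := 4) (L := M) (G := Matrix.specialUnitaryGroup (Fin 2) ℂ) ρ hρ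
    (β - c) (0 : Site 4 M) (i := 0) (j := 1) (by decide)
  rw [card_plaquette_four] at hmean
  have hE : wilsonExpectation ρ (β - c) (plaquetteCost (G := Matrix.specialUnitaryGroup (Fin 2) ℂ) ρ (0 : Site 4 M) 0 1) ≤
      27 / (β - c) + 2 * Real.log (β - c) / (M * (β - c)) :=
    wilsonExpectation_two_sub_trace_le_su2 (M := M) hβc (0 : Site 4 M) (i := 0) (j := 1) (by decide)
  have hS : wilsonExpectation ρ (β - c) (wilsonAction (d := 4) (L := M) (G := Matrix.specialUnitaryGroup (Fin 2) ℂ) ρ) ≤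
      6 * (M : ℝ) ^ 4 * (27 / (β - c) + 2 * Real.log (β - c) / (M * (β - c))) := by
    rw [hmean]
    push_cast
    exact mul_le_mul_of_nonneg_left hE (by positivity)
  have h2 := mul_le_mul_of_nonneg_left hS hc
  linarith

/-- **Small-`c` chessboard bound, one orientation.**  `SU(2)` fundamental, `M` odd `≥ 3`, `0 ≤ c`, `β − c ≥ 2`; `P` of one orientation:
`⟨exp(c Σ_{q∈P} φ_q)⟩_{Λ_M,β} ≤ exp(#P · 6c · (27/(β−c) + 2 log(β−c)/(M(β−c))))` — linear in `c/β`. [folklore] -/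
theorem su2_wilsonExpectation_expObs_le_linear_orient {M : ℕ} [NeZero M] (hM : Odd M) (hM3 : 3 ≤ M) {β c : ℝ} (hc : 0 ≤ c)
    (hβc : 2 ≤ β - c) (o : {p : Fin 4 × Fin 4 // p.1 < p.2}) (P : Finset (Plaquette 4 M)) (hP : ∀ q ∈ P, q.2 = o) :
    wilsonExpectation (fundamentalRep (Fin 2)) β (expObs (G := Matrix.specialUnitaryGroup (Fin 2) ℂ) (fundamentalRep (Fin 2)) c P) ≤
      Real.exp (#P * (6 * c * (27 / (β - c) + 2 * Real.log (β - c) / (M * (β - c))))) := by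
  haveI : Fact (1 < M) := ⟨by omega⟩
  have hM0 : (0 : ℝ) < M := by exact_mod_cast (show 0 < M by omega)
  have h1 := wilsonExpectation_expObs_le_exp_card (d := 4) (L := M) (G := Matrix.specialUnitaryGroup (Fin 2) ℂ)
    (fundamentalRep (Fin 2)) hM hM3 (continuous_fundamentalRep (Fin 2)) (β := β) (c := c) hc (by linarith) o P hP
  refine h1.trans (Real.exp_le_exp.2 ?_)
  have h2 := su2_torusLogPartition_sub_le_linear (M := M) hc hβc
  have h3 : (#P : ℝ) / (M : ℝ) ^ 4 * (c * (6 * (M : ℝ) ^ 4 * (27 / (β - c) + 2 * Real.log (β - c) / (M * (β - c))))) =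
      #P * (6 * c * (27 / (β - c) + 2 * Real.log (β - c) / (M * (β - c)))) := by
    field_simp
  calc (#P : ℝ) / (M : ℝ) ^ 4 * (torusLogPartition 4 (fundamentalRep (Fin 2)) (β - c) M -
          torusLogPartition 4 (G := Matrix.specialUnitaryGroup (Fin 2) ℂ) (fundamentalRep (Fin 2)) β M)
      ≤ (#P : ℝ) / (M : ℝ) ^ 4 * (c * (6 * (M : ℝ) ^ 4 * (27 / (β - c) + 2 * Real.log (β - c) / (M * (β - c))))) :=
        mul_le_mul_of_nonneg_left h2 (by positivity)
    _ = #P * (6 * c * (27 / (β - c) + 2 * Real.log (β - c) / (M * (β - c)))) := h3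

/-- **Small-`c` chessboard bound, all orientations, clean constants.**  `SU(2)` fundamental, `M` odd `≥ 3`, `β ≥ 4`, `0 ≤ c ≤ β/12`; EVERY finite `P`:
`⟨exp(c Σ_{q∈P} φ_q)⟩_{Λ_M,β} ≤ exp(#P · (c/β) · (1944 + 144 log β/M))` — Jensen over the six orientation classes, the one-orientation bound at `6c`
(`β − 6c ≥ β/2 ≥ 2`, so `27/(β−6c) ≤ 54/β`, `2 log(β−6c)/(M(β−6c)) ≤ 4 log β/(Mβ)`).  The Gaussian-scale currency: the exponent per plaquette is
`≍ c/β`. [folklore] -/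
theorem su2_wilsonExpectation_expObs_le_linear {M : ℕ} [NeZero M] (hM : Odd M) (hM3 : 3 ≤ M) {β c : ℝ} (hβ : 4 ≤ β)
    (hc : 0 ≤ c) (hcβ : c ≤ β / 12) (P : Finset (Plaquette 4 M)) :
    wilsonExpectation (fundamentalRep (Fin 2)) β (expObs (G := Matrix.specialUnitaryGroup (Fin 2) ℂ) (fundamentalRep (Fin 2)) c P) ≤
      Real.exp (#P * (c / β * (1944 + 144 * Real.log β / M))) := by
  classical
  set ρ := fundamentalRep (Fin 2) with hρdef
  have hρ : Continuous ρ := continuous_fundamentalRep (Fin 2)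
  haveI := isProbabilityMeasure_wilsonMeasure (d := 4) (L := M) (G := Matrix.specialUnitaryGroup (Fin 2) ℂ) ρ hρ β
  haveI : Nonempty {p : Fin 4 × Fin 4 // p.1 < p.2} := ⟨⟨((0 : Fin 4), (1 : Fin 4)), by decide⟩⟩
  have hM0 : (0 : ℝ) < M := by exact_mod_cast (show 0 < M by omega)
  have hβ0 : 0 < β := by linarith
  -- orientation classes
  set Pc : {p : Fin 4 × Fin 4 // p.1 < p.2} → Finset (Plaquette 4 M) := fun o => P.filter fun q => q.2 = o with hPc
  have hPc : ∀ o, ∀ q ∈ Pc o, q.2 = o := fun o q hq => (mem_filter.1 hq).2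
  have hcard : ∀ o, #(Pc o) ≤ #P := fun o => card_filter_le _ _
  -- the per-class constant at `6c`
  have h6c : 2 ≤ β - 6 * c := by linarith
  set K : ℝ := 6 * (6 * c) * (27 / (β - 6 * c) + 2 * Real.log (β - 6 * c) / (M * (β - 6 * c))) with hK
  have hlogle : Real.log (β - 6 * c) ≤ Real.log β := Real.log_le_log (by linarith) (by linarith)
  have hlog0 : 0 ≤ Real.log (β - 6 * c) := Real.log_nonneg (by linarith)
  have hlogβ : 0 ≤ Real.log β := Real.log_nonneg (by linarith)
  have hK0 : 0 ≤ K := by rw [hK]; positivity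
  have hKle : K ≤ c / β * (1944 + 144 * Real.log β / M) := by
    have hden : β / 2 ≤ β - 6 * c := by linarith
    have hden0 : 0 < β - 6 * c := by linarith
    have h1 : 27 / (β - 6 * c) ≤ 54 / β := by
      rw [div_le_div_iff₀ hden0 hβ0]; nlinarith
    have h2 : 2 * Real.log (β - 6 * c) / (M * (β - 6 * c)) ≤ 4 * Real.log β / (M * β) := by
      rw [div_le_div_iff₀ (by positivity) (by positivity)]
      have := mul_le_mul hlogle hden (by linarith) hlogβ
      nlinarith [mul_nonneg hM0.le hlogβ, mul_nonneg hM0.le hlog0]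
    have h3 : 27 / (β - 6 * c) + 2 * Real.log (β - 6 * c) / (M * (β - 6 * c)) ≤ 54 / β + 4 * Real.log β / (M * β) := add_le_add h1 h2
    have h4 := mul_le_mul_of_nonneg_left h3 (show 0 ≤ 6 * (6 * c) by positivity)
    have e : 6 * (6 * c) * (54 / β + 4 * Real.log β / (M * β)) = c / β * (1944 + 144 * Real.log β / M) := by
      field_simp
      ring
    rw [hK]
    linarith [h4, e.le]
  -- pointwise Jensen over the orientations
  have hpt : ∀ U : GaugeConfig 4 M (Matrix.specialUnitaryGroup (Fin 2) ℂ),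
      expObs (G := Matrix.specialUnitaryGroup (Fin 2) ℂ) ρ c P U ≤
        ∑ o : {p : Fin 4 × Fin 4 // p.1 < p.2}, (6 : ℝ)⁻¹ * expObs ρ (6 * c) (Pc o) U := by
    intro U
    have hsplit : c * ∑ q ∈ P, plaquetteCost ρ q.1 q.2.1.1 q.2.1.2 U =
        ∑ o : {p : Fin 4 × Fin 4 // p.1 < p.2}, c * ∑ q ∈ Pc o, plaquetteCost ρ q.1 q.2.1.1 q.2.1.2 U := by
      rw [← mul_sum]
      congr 1
      exact (sum_fiberwise_of_maps_to (s := P) (t := (univ : Finset {p : Fin 4 × Fin 4 // p.1 < p.2}))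
        (g := fun q : Plaquette 4 M => q.2) (fun q _ => mem_univ _)
        (fun q : Plaquette 4 M => plaquetteCost ρ q.1 q.2.1.1 q.2.1.2 U)).symm
    unfold expObs
    rw [hsplit]
    refine (exp_sum_le_card_inv_mul_sum_exp _).trans (le_of_eq ?_)
    rw [show Fintype.card {p : Fin 4 × Fin 4 // p.1 < p.2} = 6 by decide, mul_sum]
    refine sum_congr rfl fun o _ => ?_
    push_cast
    ring_nf
  -- integrate
  have hint : ∀ o : {p : Fin 4 × Fin 4 // p.1 < p.2}, Integrable (fun U => (6 : ℝ)⁻¹ *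
      expObs (G := Matrix.specialUnitaryGroup (Fin 2) ℂ) ρ (6 * c) (Pc o) U) (wilsonMeasure (d := 4) (L := M) ρ β) := by
    intro o
    obtain ⟨C, hC⟩ := exists_abs_expObs_le (d := 4) (L := M) (G := Matrix.specialUnitaryGroup (Fin 2) ℂ) ρ hρ (6 * c) (Pc o)
    exact (Integrable.of_bound (measurable_expObs ρ hρ (6 * c) (Pc o)).aestronglyMeasurable C
      (ae_of_all _ fun U => by rw [Real.norm_eq_abs]; exact hC U)).const_mul _
  have hintP : Integrable (expObs (G := Matrix.specialUnitaryGroup (Fin 2) ℂ) ρ c P) (wilsonMeasure (d := 4) (L := M) ρ β) := by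
    obtain ⟨C, hC⟩ := exists_abs_expObs_le (d := 4) (L := M) (G := Matrix.specialUnitaryGroup (Fin 2) ℂ) ρ hρ c P
    exact Integrable.of_bound (measurable_expObs ρ hρ c P).aestronglyMeasurable C
      (ae_of_all _ fun U => by rw [Real.norm_eq_abs]; exact hC U)
  have hstep : wilsonExpectation ρ β (expObs (G := Matrix.specialUnitaryGroup (Fin 2) ℂ) ρ c P) ≤
      ∑ o : {p : Fin 4 × Fin 4 // p.1 < p.2}, (6 : ℝ)⁻¹ *
        wilsonExpectation ρ β (expObs (G := Matrix.specialUnitaryGroup (Fin 2) ℂ) ρ (6 * c) (Pc o)) := by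
    unfold wilsonExpectation
    calc ∫ U, expObs ρ c P U ∂(wilsonMeasure ρ β)
        ≤ ∫ U, ∑ o : {p : Fin 4 × Fin 4 // p.1 < p.2}, (6 : ℝ)⁻¹ * expObs ρ (6 * c) (Pc o) U ∂(wilsonMeasure ρ β) :=
          integral_mono hintP (integrable_finsetSum _ fun o _ => hint o) hpt
      _ = ∑ o : {p : Fin 4 × Fin 4 // p.1 < p.2}, (6 : ℝ)⁻¹ * ∫ U, expObs ρ (6 * c) (Pc o) U ∂(wilsonMeasure ρ β) := by
          rw [integral_finsetSum _ fun o _ => hint o]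
          refine sum_congr rfl fun o _ => ?_
          rw [integral_const_mul]
  refine hstep.trans ?_
  have hclass : ∀ o : {p : Fin 4 × Fin 4 // p.1 < p.2},
      wilsonExpectation ρ β (expObs (G := Matrix.specialUnitaryGroup (Fin 2) ℂ) ρ (6 * c) (Pc o)) ≤
        Real.exp (#P * (c / β * (1944 + 144 * Real.log β / M))) := by
    intro o
    refine (su2_wilsonExpectation_expObs_le_linear_orient hM hM3 (c := 6 * c) (by positivity) h6c o (Pc o) (hPc o)).trans ?_
    refine Real.exp_le_exp.2 ?_
    have hPo : (#(Pc o) : ℝ) ≤ #P := by exact_mod_cast hcard o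
    calc (#(Pc o) : ℝ) * K ≤ #P * K := mul_le_mul_of_nonneg_right hPo hK0
      _ ≤ #P * (c / β * (1944 + 144 * Real.log β / M)) := mul_le_mul_of_nonneg_left hKle (Nat.cast_nonneg _)
  calc ∑ o : {p : Fin 4 × Fin 4 // p.1 < p.2}, (6 : ℝ)⁻¹ *
        wilsonExpectation ρ β (expObs (G := Matrix.specialUnitaryGroup (Fin 2) ℂ) ρ (6 * c) (Pc o))
      ≤ ∑ _o : {p : Fin 4 × Fin 4 // p.1 < p.2}, (6 : ℝ)⁻¹ * Real.exp (#P * (c / β * (1944 + 144 * Real.log β / M))) :=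
        sum_le_sum fun o _ => mul_le_mul_of_nonneg_left (hclass o) (by norm_num)
    _ = Real.exp (#P * (c / β * (1944 + 144 * Real.log β / M))) := by
        rw [sum_const, card_univ, show Fintype.card {p : Fin 4 × Fin 4 // p.1 < p.2} = 6 by decide, nsmul_eq_mul]
        ring

end Summit.QuantumFields.YangMills.Cruxes.UVSeamRec.Chessboard

end
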